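import Mathlib

/-!
# `FigureEightIsTwoSmyth`: the algebra behind the predicted chain (helper)

Item stmt-KontsevichZagierPeriods-5203 of route K2SymbolChains (the unfolded torus representation
of `M(A_{4₁})`, `A(L,M) = M⁴+M⁻⁴−M²−M⁻²−2−L−L⁻¹`, is KZ-equivalent to that of `2·M(1+x+y)`). The
predicted chain is JensenMove (crux stmt-5199) in the circle variable `s`, then SteinbergChain
(crux stmt-5198) along the shapes of the two ideal tetrahedra of the figure-eight complement. This
file proves the finite ALGEBRA those steps consume (no analysis, no moves, no new definitions), so
that the post-crux prover only has bookkeeping left (see the evidence file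
`FigureEightIsTwoSmyth-chain.md` attached to the item). Notation in the docstrings:
`c(t) = (1−t²)/(1+t²)`, `σ(t) = 2t/(1+t²)` (so `e(t) = c(t) + iσ(t) = e^{iθ}`, `θ = 2 arctan t`),
`g(t) = 16c⁴ − 20c² + 2 = 2cos4θ − 2cos2θ − 2`, and the item's fibre bound
`F(t,s) = g(t) − 2c(s) = A(e^{iφ}, e^{iθ})` (real on the torus).

* Jensen side: `F² = |e(s) − L₊|²·|e(s) − L₋|²` when `g ≤ −2` (real roots `L± = (g ∓ √(g²−4))/2`
  of `L² − gL + 1`) and `F² = |e(s) − β|²·|e(s) − β̄|²` when `|g| ≤ 2` (roots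
  `β = (g + i√(4−g²))/2` on the unit circle); the range split `g < −2 ↔ (t ≠ 0 ∧ t² < 1/3) ∨ 3 < t²`
  (the base `T_A` of the one surviving Jensen term) and `g ≤ 2`.
* K₂ side: on the gluing variety `z(1−z)·w(1−w) = 1` of the figure-eight knot complement the pair
  `L = −z(1−z)`, `m = M² = w(1−z)` satisfies `L + L⁻¹ = m² + m⁻² − m − m⁻¹ − 2` (`A(L,M) = 0`), and
  `(z(1−z))⁻¹ = w(1−w)`, `(w(1−z))⁻¹ = z(1−w)` — the identities behind the INTEGRAL symbol
  decomposition `L ∧ m = z ∧ (1−z) + w ∧ (1−w)` (no division by 2) that feeds SteinbergChain.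
-/

-- single-conjunct summit: Sub = Summit, so the namespace segment repeats by design (CONVENTIONS §2)
set_option linter.dupNamespace false

namespace Summit.KontsevichZagierPeriods.KontsevichZagierPeriods.Theorems

/-- `c(t)² + σ(t)² = 1` for the rational parametrisation of the circle. [folklore] -/
theorem ratCircle_sq_add_sq (t : ℝ) :
    ((1 - t ^ 2) / (1 + t ^ 2)) ^ 2 + (2 * t / (1 + t ^ 2)) ^ 2 = 1 := by
  have h : (1 + t ^ 2 : ℝ) ≠ 0 := by positivity
  field_simp
  ring

/-- **Jensen factorisation, real-root case** (pure algebra): if `c² + σ² = 1`, `L₊ + L₋ = g` and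
`L₊L₋ = 1` then `(g − 2c)² = ((c − L₊)² + σ²)·((c − L₋)² + σ²)`, i.e.
`|e − L₊|²|e − L₋|² = |e² − g e + 1|² = (2 Re e − g)²` for `|e| = 1`. [folklore] -/
theorem sq_sub_two_mul_eq_mul_of_real_roots (g c σ Lp Lm : ℝ) (hcs : c ^ 2 + σ ^ 2 = 1)
    (hsum : Lp + Lm = g) (hprod : Lp * Lm = 1) :
    (g - 2 * c) ^ 2 = ((c - Lp) ^ 2 + σ ^ 2) * ((c - Lm) ^ 2 + σ ^ 2) := by
  have hσ : σ ^ 2 = 1 - c ^ 2 := by linarith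
  subst hsum
  rw [hσ]
  linear_combination (-(Lp * Lm - 1 - 2 * c * (Lp + Lm) + 4 * c ^ 2)) * hprod

/-- **Jensen factorisation, unit-circle-root case** (pure algebra): if `c² + σ² = 1`, `2b₁ = g` and
`b₁² + b₂² = 1` then `(g − 2c)² = ((c − b₁)² + (σ − b₂)²)·((c − b₁)² + (σ + b₂)²)`, i.e.
`|e − β|²|e − β̄|² = (2 Re e − g)²` for `|e| = |β| = 1`, `β + β̄ = g`. [folklore] -/
theorem sq_sub_two_mul_eq_mul_of_circle_roots (g c σ b₁ b₂ : ℝ) (hcs : c ^ 2 + σ ^ 2 = 1)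
    (hre : 2 * b₁ = g) (hb : b₁ ^ 2 + b₂ ^ 2 = 1) :
    (g - 2 * c) ^ 2 = ((c - b₁) ^ 2 + (σ - b₂) ^ 2) * ((c - b₁) ^ 2 + (σ + b₂) ^ 2) := by
  subst hre
  have h1 : (c - b₁) ^ 2 + (σ - b₂) ^ 2 = 2 - 2 * c * b₁ - 2 * σ * b₂ := by
    linear_combination hcs + hb
  have h2 : (c - b₁) ^ 2 + (σ + b₂) ^ 2 = 2 - 2 * c * b₁ + 2 * σ * b₂ := by
    linear_combination hcs + hb
  rw [h1, h2]
  linear_combination (4 * b₂ ^ 2) * hcs + (4 - 4 * c ^ 2) * hb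

/-- The real roots `L± = (g ∓ √(g² − 4))/2` of `L² − gL + 1` for `g ≤ −2`: sum `g`, product `1`,
and `L₊ ≤ −1` (so `|L₊| ≥ 1 ≥ |L₋|`). [folklore] -/
theorem real_roots_of_le_neg_two (g : ℝ) (hg : g ≤ -2) :
    (g - Real.sqrt (g ^ 2 - 4)) / 2 + (g + Real.sqrt (g ^ 2 - 4)) / 2 = g ∧
    (g - Real.sqrt (g ^ 2 - 4)) / 2 * ((g + Real.sqrt (g ^ 2 - 4)) / 2) = 1 ∧
    (g - Real.sqrt (g ^ 2 - 4)) / 2 ≤ -1 := by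
  have h4 : 0 ≤ g ^ 2 - 4 := by nlinarith
  have hs := Real.sq_sqrt h4
  have hs0 := Real.sqrt_nonneg (g ^ 2 - 4)
  exact ⟨by ring, by nlinarith, by linarith⟩

/-- For `g < −2` the root of larger modulus satisfies `L₊ < −1` strictly (so the surviving Jensen
term has non-empty fibres `1 < u < L₊²`), and `|L₋| < 1`. [folklore] -/
theorem real_roots_of_lt_neg_two (g : ℝ) (hg : g < -2) :
    (g - Real.sqrt (g ^ 2 - 4)) / 2 < -1 ∧
    -1 < (g + Real.sqrt (g ^ 2 - 4)) / 2 ∧ (g + Real.sqrt (g ^ 2 - 4)) / 2 < 0 := by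
  have h4 : 0 < g ^ 2 - 4 := by nlinarith
  have hs := Real.sq_sqrt h4.le
  have hs0 := Real.sqrt_pos.mpr h4
  refine ⟨by linarith, ?_, ?_⟩
  · nlinarith
  · have : Real.sqrt (g ^ 2 - 4) < -g := by
      rw [← Real.sqrt_sq (by linarith : 0 ≤ -g)]
      exact Real.sqrt_lt_sqrt h4.le (by nlinarith)
    linarith

/-- The unit-circle roots `β = (g ± i√(4 − g²))/2` of `L² − gL + 1` for `|g| ≤ 2`:
`(g/2)² + (√(4−g²)/2)² = 1`. [folklore] -/
theorem circle_roots_of_abs_le_two (g : ℝ) (hg : -2 ≤ g) (hg' : g ≤ 2) :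
    (g / 2) ^ 2 + (Real.sqrt (4 - g ^ 2) / 2) ^ 2 = 1 := by
  have h4 : 0 ≤ 4 - g ^ 2 := by nlinarith
  have hs := Real.sq_sqrt h4
  nlinarith

/-- **Jensen factorisation of the item's fibre bound, real-root case.** Write `c = (1−t²)/(1+t²)`,
`g = 16c⁴ − 20c² + 2`, `L± = (g ∓ √(g²−4))/2`. If `g ≤ −2` then, for every `s`,
`(g − 2c(s))² = ((c(s) − L₊)² + (σ(s) − 0)²)·((c(s) − L₋)² + (σ(s) − 0)²)`: the left side is the
item's `F(t,s)²` (fibre bound of `r`), the right side the product of the two JensenMove fibre bounds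
`|e(s) − α|²` with centres `α = (L±, 0)`. With the unfolded product rule
(`KZ.of_sub_of_sub_mem_relations_mul`) this is the pointwise input of the first two Jensen steps.
[folklore] -/
theorem torusF_sq_eq_mul_of_real_roots (t s : ℝ)
    (hg : 16 * ((1 - t ^ 2) / (1 + t ^ 2)) ^ 4 - 20 * ((1 - t ^ 2) / (1 + t ^ 2)) ^ 2 + 2 ≤ -2) :
    let g : ℝ := 16 * ((1 - t ^ 2) / (1 + t ^ 2)) ^ 4 - 20 * ((1 - t ^ 2) / (1 + t ^ 2)) ^ 2 + 2
    (g - 2 * (1 - s ^ 2) / (1 + s ^ 2)) ^ 2 =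
      (((1 - s ^ 2) / (1 + s ^ 2) - (g - Real.sqrt (g ^ 2 - 4)) / 2) ^ 2 +
          (2 * s / (1 + s ^ 2) - 0) ^ 2) *
        (((1 - s ^ 2) / (1 + s ^ 2) - (g + Real.sqrt (g ^ 2 - 4)) / 2) ^ 2 +
          (2 * s / (1 + s ^ 2) - 0) ^ 2) := by
  intro g
  obtain ⟨hsum, hprod, -⟩ := real_roots_of_le_neg_two g hg
  have h := sq_sub_two_mul_eq_mul_of_real_roots g ((1 - s ^ 2) / (1 + s ^ 2)) (2 * s / (1 + s ^ 2))
    _ _ (ratCircle_sq_add_sq s) hsum hprod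
  rw [sub_zero, mul_div_assoc]
  exact h

/-- **Jensen factorisation of the item's fibre bound, unit-circle case.** With `c`, `g` as above, if
`−2 ≤ g ≤ 2` then `(g − 2c(s))² = ((c(s) − g/2)² + (σ(s) − √(4−g²)/2)²)·((c(s) − g/2)² + (σ(s) + √(4−g²)/2)²)`;
both JensenMove centres `(g/2, ±√(4−g²)/2)` have modulus `1`, so both second representations are
EMPTY and `r` restricted to the base `{−2 ≤ g ≤ 2}` is a relation. [folklore] -/
theorem torusF_sq_eq_mul_of_circle_roots (t s : ℝ)
    (hg : -2 ≤ 16 * ((1 - t ^ 2) / (1 + t ^ 2)) ^ 4 - 20 * ((1 - t ^ 2) / (1 + t ^ 2)) ^ 2 + 2)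
    (hg' : 16 * ((1 - t ^ 2) / (1 + t ^ 2)) ^ 4 - 20 * ((1 - t ^ 2) / (1 + t ^ 2)) ^ 2 + 2 ≤ 2) :
    let g : ℝ := 16 * ((1 - t ^ 2) / (1 + t ^ 2)) ^ 4 - 20 * ((1 - t ^ 2) / (1 + t ^ 2)) ^ 2 + 2
    (g - 2 * (1 - s ^ 2) / (1 + s ^ 2)) ^ 2 =
      (((1 - s ^ 2) / (1 + s ^ 2) - g / 2) ^ 2 + (2 * s / (1 + s ^ 2) - Real.sqrt (4 - g ^ 2) / 2) ^ 2) *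
        (((1 - s ^ 2) / (1 + s ^ 2) - g / 2) ^ 2 +
          (2 * s / (1 + s ^ 2) + Real.sqrt (4 - g ^ 2) / 2) ^ 2) := by
  intro g
  have hb := circle_roots_of_abs_le_two g hg hg'
  have h := sq_sub_two_mul_eq_mul_of_circle_roots g ((1 - s ^ 2) / (1 + s ^ 2))
    (2 * s / (1 + s ^ 2)) _ _ (ratCircle_sq_add_sq s) (by ring) hb
  rw [mul_div_assoc]
  exact h

/-- `g(t) + 2 = −16 t² (3t² − 1)(t² − 3)/(1 + t²)⁴` (`= 4(4c²−1)(c²−1)`). [folklore] -/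
theorem torusG_add_two (t : ℝ) :
    16 * ((1 - t ^ 2) / (1 + t ^ 2)) ^ 4 - 20 * ((1 - t ^ 2) / (1 + t ^ 2)) ^ 2 + 2 + 2 =
      -(16 / (1 + t ^ 2) ^ 4 * (t ^ 2 * ((3 * t ^ 2 - 1) * (t ^ 2 - 3)))) := by
  have h : (1 + t ^ 2 : ℝ) ≠ 0 := by positivity
  field_simp
  ring

/-- `g(t) ≤ 2` for all `t` (`g − 2 = 4c²(4c² − 5)` and `c² ≤ 1`), so off the base `{g < −2}` one
is in the unit-circle case `−2 ≤ g ≤ 2`. [folklore] -/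
theorem torusG_le_two (t : ℝ) :
    16 * ((1 - t ^ 2) / (1 + t ^ 2)) ^ 4 - 20 * ((1 - t ^ 2) / (1 + t ^ 2)) ^ 2 + 2 ≤ 2 := by
  set c : ℝ := (1 - t ^ 2) / (1 + t ^ 2) with hc
  have hc1 : c ^ 2 ≤ 1 := by
    nlinarith [ratCircle_sq_add_sq t, sq_nonneg (2 * t / (1 + t ^ 2))]
  nlinarith [sq_nonneg c, mul_nonneg (sq_nonneg c) (sub_nonneg.mpr hc1)]

/-- **The base of the surviving Jensen term**: `g(t) < −2` (two real roots, `|L₊| > 1`) iff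
`0 < t² < 1/3` or `t² > 3`, i.e. `cos 2θ ∈ (−1/2, 1)` with `θ = 2 arctan t ∉ πℤ` — the four arcs
`T_A`; on the complement `−2 ≤ g ≤ 2`. [folklore] -/
theorem torusG_lt_neg_two_iff (t : ℝ) :
    16 * ((1 - t ^ 2) / (1 + t ^ 2)) ^ 4 - 20 * ((1 - t ^ 2) / (1 + t ^ 2)) ^ 2 + 2 < -2 ↔
      (t ≠ 0 ∧ t ^ 2 < 1 / 3) ∨ 3 < t ^ 2 := by
  have hk : 0 < 16 / (1 + t ^ 2) ^ 4 := by positivity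
  have e := torusG_add_two t
  have step1 : 16 * ((1 - t ^ 2) / (1 + t ^ 2)) ^ 4 - 20 * ((1 - t ^ 2) / (1 + t ^ 2)) ^ 2 + 2 < -2 ↔
      0 < t ^ 2 * ((3 * t ^ 2 - 1) * (t ^ 2 - 3)) := by
    constructor
    · intro h
      have h' : 0 < 16 / (1 + t ^ 2) ^ 4 * (t ^ 2 * ((3 * t ^ 2 - 1) * (t ^ 2 - 3))) := by
        linarith
      exact (mul_pos_iff_of_pos_left hk).mp h'
    · intro h
      have h' : 0 < 16 / (1 + t ^ 2) ^ 4 * (t ^ 2 * ((3 * t ^ 2 - 1) * (t ^ 2 - 3))) :=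
        mul_pos hk h
      linarith
  rw [step1]
  constructor
  · intro h
    have ht : t ≠ 0 := by
      rintro rfl
      simp at h
    have ht2 : 0 < t ^ 2 := by positivity
    have hq : 0 < (3 * t ^ 2 - 1) * (t ^ 2 - 3) := (mul_pos_iff_of_pos_left ht2).mp h
    rcases lt_or_ge (t ^ 2) 3 with h3 | h3
    · left
      refine ⟨ht, ?_⟩
      by_contra hcon
      have hcon' := not_lt.mp hcon
      nlinarith
    · right
      rcases eq_or_lt_of_le h3 with h3' | h3'
      · rw [← h3'] at hq; norm_num at hq
      · exact h3'
  · rintro (⟨ht, h13⟩ | h3)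
    · have ht2 : 0 < t ^ 2 := by positivity
      apply mul_pos ht2
      nlinarith
    · have ht2 : 0 < t ^ 2 := by linarith
      apply mul_pos ht2
      nlinarith

/-- **The figure-eight A-polynomial from the gluing variety** (over any field): on
`z(1−z)·w(1−w) = 1` — the edge equation of Thurston's ideal triangulation of the figure-eight knot
complement by two tetrahedra of shapes `z`, `w` (Thurston, *The geometry and topology of
3-manifolds*, §4.3) — the eigenvalue/holonomy pair `L = −z(1−z)`, `m = M² = w(1−z)` satisfies
`L + L⁻¹ = m² + m⁻² − m − m⁻¹ − 2`, which is `A(L,M) = 0` for `A = M⁴+M⁻⁴−M²−M⁻²−2−L−L⁻¹`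
(the A-polynomial of `4₁`, Cooper–Culler–Gillet–Long–Shalen 1994; `π m(A) = vol(4₁)`, Boyd 2002).
Found here by exhaustive monomial search; proved by `ring` modulo the gluing relation. [folklore] -/
theorem figureEight_gluing_aPolynomial {K : Type*} [Field K] (z w : K)
    (hG : z * (1 - z) * (w * (1 - w)) = 1) :
    -(z * (1 - z)) + (-(z * (1 - z)))⁻¹ =
      (w * (1 - z)) ^ 2 + ((w * (1 - z)) ^ 2)⁻¹ - w * (1 - z) - (w * (1 - z))⁻¹ - 2 := by
  have hP : (z * (1 - z))⁻¹ = w * (1 - w) := inv_eq_of_mul_eq_one_right hG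
  have hm : (w * (1 - z))⁻¹ = z * (1 - w) :=
    inv_eq_of_mul_eq_one_right (by linear_combination hG)
  rw [inv_neg, hP, ← inv_pow, hm]
  linear_combination (-2 : K) * hG

/-- The two multiplicative identities on the gluing variety that make the symbol decomposition
`L ∧ m = z ∧ (1−z) + w ∧ (1−w)` INTEGRAL (`P ∧ w = −(Q ∧ w) = w ∧ (1−w)` with `P = z(1−z)`,
`Q = w(1−w) = P⁻¹`, and `m⁻¹ = z(1−w)`): `(z(1−z))⁻¹ = w(1−w)` and `(w(1−z))⁻¹ = z(1−w)`.
[folklore] -/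
theorem figureEight_gluing_inv {K : Type*} [Field K] (z w : K)
    (hG : z * (1 - z) * (w * (1 - w)) = 1) :
    (z * (1 - z))⁻¹ = w * (1 - w) ∧ (w * (1 - z))⁻¹ = z * (1 - w) :=
  ⟨inv_eq_of_mul_eq_one_right hG, inv_eq_of_mul_eq_one_right (by linear_combination hG)⟩

/-- Along the Mahler path both shapes lie on the line `Re = 1/2`: for `z = 1/2 + iy` one has
`1 − z = z̄`, hence `z(1−z) = |z|² = 1/4 + y²` is REAL; with `z(1−z) = −L ≥ 1` this is
`y² ≥ 3/4` (endpoints `y = ∓√3/2`, `z = ζ₆^{∓1}`, the regular ideal tetrahedron), and then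
`w = m/(1−z) = m·z/(1/4 + y²)` has `|w| = |1 − w|`, i.e. `Re w = 1/2` as well. [folklore] -/
theorem mul_one_sub_of_re_eq_half (y : ℝ) :
    (⟨1 / 2, y⟩ : ℂ) * (1 - ⟨1 / 2, y⟩) = ⟨1 / 4 + y ^ 2, 0⟩ := by
  apply Complex.ext <;> simp [sq] <;> ring

end Summit.KontsevichZagierPeriods.KontsevichZagierPeriods.Theorems
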